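import Summits.CriticalPhenomena.PercolationContinuityZ3.Theorems.PercNearOneGluingNoHeavyLowerTailApexTwoSumGlue
import Summits.CriticalPhenomena.PercolationContinuityZ3.Theorems.PercNearOneGluingNoHeavyLowerTailThreeSumCells
import HarnessLib

/-!
# `NoHeavyLowerTail` (stmt-CriticalPhenomena-4575) — 2-sums through a TERMINAL (the `{b, v}`-cut), part 1:
# join rules and the separation rule for two pieces glued along `{b, v}`

Support file (prover prim-gen-kcluster gen 72; `--supports stmt-CriticalPhenomena-4575`).  Pure graph combinatorics: no
measures, no definitions, no named facts, no sorries.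

SETTING (the "terminal–hub 2-cut" of KCLUSTER-gen69 §5.2(b) / THEOREM-3SUM Prop. 4.2, at the level of configurations).  Finite `V`;
apex `a`, terminals `b, c`, hub `v` (all distinct); edge supports `DX DY : Finset (Sym2 V)` MEETING ONLY IN `{v, b}` (`hsepD`); the apex `a`
is private to `DX` (no pair of `DY` contains `a`), the terminal `c` is private to `DY`.  Blocks `ζ_X = ω ∩ DX`, `ζ_Y = ω ∖ DX`; clusters
`Gladkov.cl`, support separation `RefinedRowR3.Sep`.  (The wired count at `T = {v, b}` is `ApexTwoSum.clusterCount_empty_eq_wired_two` /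
`ApexTwoSum.kT_add` with `(a, h) := (v, b)`.)

* `TerminalTwoSum.glued_b_iff / glued_v_iff` — `b ∈ C(a)` iff `b ∈ C_X(a)`, or `v ∈ C_X(a)` and `b ~ v` in some block; symmetrically for `v`
  (instances of `ThreeSum.glued_atoms` for the triple `(a; b, v)`, the apex being isolated in the `Y`-block).
* `TerminalTwoSum.glued_c_iff` — `c ∈ C(a)` iff (`b ∈ C(a)` and `c ∈ C_Y(b)`) or (`v ∈ C(a)` and `c ∈ C_Y(v)`) (`APL.glued_cl_core`).
* `TerminalTwoSum.glued_bv_iff` — `v ∈ C(b)` iff in some block (`APL.series_oc_iff`).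
* SEPARATION RULE: if `b ∉ C(a)` and `v ∈ C(a)` then `C(a)` meets every `b–c` path of `DX ∪ DY` iff `C_Y(v)` meets every `b–c` path of `DY`
  (`TerminalTwoSum.sep_iff_of_mem`); if `b, v ∉ C(a)` and `b, c` are joined in the support `DY`, then `C(a)` does not separate (`not_sep_of_not_mem`).
-/

namespace Summit.CriticalPhenomena.PercolationContinuityZ3.Theorems

namespace TerminalTwoSum

open SimpleGraph Finset Literature.Probability.Percolation Literature.Probability.Percolation.Gladkov
open Literature.Probability.LatticeModels RefinedRowR3 ThreePointLB APL
open scoped Classical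

variable {V : Type*} [Fintype V] {DX DY : Finset (Sym2 V)} {a b c v : V}

/-! ### Join rules in event form -/

section Join

variable (hab : a ≠ b) (hav : a ≠ v) (hac : a ≠ c) (hbc : b ≠ c) (hvc : v ≠ c)
  (hsepD : ∀ x : V, (∃ e ∈ DX, x ∈ e) → (∃ e ∈ DY, x ∈ e) → (x = v ∨ x = b))
  (haY : ∀ e ∈ DY, a ∉ e) (hcX : ∀ e ∈ DX, c ∉ e)

omit [Fintype V] in
include hsepD in
/-- Three-name form of the gluing hypothesis (roles `(a; b, v)`). [this work] -/
theorem hsep3 : ∀ x : V, (∃ e ∈ DX, x ∈ e) → (∃ e ∈ DY, x ∈ e) → (x = a ∨ x = b ∨ x = v) :=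
  fun x h1 h2 => (hsepD x h1 h2).elim (fun h => Or.inr (Or.inr h)) (fun h => Or.inr (Or.inl h))

include hab hav haY in
/-- The apex is isolated in the `Y`-block: `b, v ∉ C_Y(a)`. [this work] -/
theorem not_mem_clY {ω : BondConfig V} (hω : ω ⊆ ↑DX ∪ ↑DY) :
    (ω \ ↑DX) ∉ {η : BondConfig V | b ∈ cl η.toFinset a} ∧ (ω \ ↑DX) ∉ {η : BondConfig V | v ∈ cl η.toFinset a} := by
  simp only [Set.mem_setOf_eq]
  suffices key : ∀ ζ : Finset (Sym2 V), (∀ e, e ∈ ζ ↔ e ∈ ω \ (↑DX : Set (Sym2 V))) → b ∉ cl ζ a ∧ v ∉ cl ζ a by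
    exact key _ (fun e => by simp only [Set.mem_toFinset])
  intro ζ hζ
  have hiso : ∀ e ∈ ζ, a ∉ e := fun e he hae => by
    have he' := (hζ e).1 he
    rcases hω he'.1 with h' | h'
    · exact he'.2 h'
    · exact haY e h' hae
  exact ⟨fun h => hab (ApexTwoSum.eq_of_mem_cl_of_forall_not_mem hiso h).symm,
    fun h => hav (ApexTwoSum.eq_of_mem_cl_of_forall_not_mem hiso h).symm⟩

include hsepD hab hav haY in
/-- **Join rule for `b`**: `b ∈ C(a)` iff `b ∈ C_X(a)`, or `v ∈ C_X(a)` and `b ~ v` in some block. [this work] -/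
theorem glued_b_iff {ω : BondConfig V} (hω : ω ⊆ ↑DX ∪ ↑DY) :
    b ∈ cl ω.toFinset a ↔
      ((ω ∩ ↑DX) ∈ {η : BondConfig V | b ∈ cl η.toFinset a} ∨
        ((ω ∩ ↑DX) ∈ {η : BondConfig V | v ∈ cl η.toFinset a} ∧
          ((ω ∩ ↑DX) ∈ {η : BondConfig V | v ∈ cl η.toFinset b} ∨ (ω \ ↑DX) ∈ {η : BondConfig V | v ∈ cl η.toFinset b}))) := by
  obtain ⟨jb, -⟩ := ThreeSum.glued_atoms (a := a) (b := b) (c := v) (hsep3 hsepD) hω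
  obtain ⟨nb, nv⟩ := not_mem_clY hab hav haY hω
  rw [jb]
  constructor
  · rintro ((h1 | h1) | ⟨h2 | h2, h3⟩)
    · exact Or.inl h1
    · exact absurd h1 nb
    · exact Or.inr ⟨h2, h3⟩
    · exact absurd h2 nv
  · rintro (h1 | ⟨h2, h3⟩)
    · exact Or.inl (Or.inl h1)
    · exact Or.inr ⟨Or.inl h2, h3⟩

include hsepD hab hav haY in
/-- **Join rule for the hub `v`**: `v ∈ C(a)` iff `v ∈ C_X(a)`, or `b ∈ C_X(a)` and `b ~ v` in some block. [this work] -/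
theorem glued_v_iff {ω : BondConfig V} (hω : ω ⊆ ↑DX ∪ ↑DY) :
    v ∈ cl ω.toFinset a ↔
      ((ω ∩ ↑DX) ∈ {η : BondConfig V | v ∈ cl η.toFinset a} ∨
        ((ω ∩ ↑DX) ∈ {η : BondConfig V | b ∈ cl η.toFinset a} ∧
          ((ω ∩ ↑DX) ∈ {η : BondConfig V | v ∈ cl η.toFinset b} ∨ (ω \ ↑DX) ∈ {η : BondConfig V | v ∈ cl η.toFinset b}))) := by
  obtain ⟨-, jv⟩ := ThreeSum.glued_atoms (a := a) (b := b) (c := v) (hsep3 hsepD) hω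
  obtain ⟨nb, nv⟩ := not_mem_clY hab hav haY hω
  rw [jv]
  constructor
  · rintro ((h1 | h1) | ⟨h2 | h2, h3⟩)
    · exact Or.inl h1
    · exact absurd h1 nv
    · exact Or.inr ⟨h2, h3⟩
    · exact absurd h2 nb
  · rintro (h1 | ⟨h2, h3⟩)
    · exact Or.inl (Or.inl h1)
    · exact Or.inr ⟨Or.inl h2, h3⟩

include hsepD in
/-- **Join rule for `b ~ v`**: `v ∈ C(b)` iff in some block. [this work] -/
theorem glued_bv_iff {ω : BondConfig V} (hω : ω ⊆ ↑DX ∪ ↑DY) :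
    v ∈ cl ω.toFinset b ↔
      ((ω ∩ ↑DX) ∈ {η : BondConfig V | v ∈ cl η.toFinset b} ∨ (ω \ ↑DX) ∈ {η : BondConfig V | v ∈ cl η.toFinset b}) := by
  simp only [Set.mem_setOf_eq]
  suffices key : ∀ ζX ζY : Finset (Sym2 V), (∀ e, e ∈ ζX ↔ e ∈ ω ∩ (↑DX : Set (Sym2 V))) →
      (∀ e, e ∈ ζY ↔ e ∈ ω \ (↑DX : Set (Sym2 V))) → (v ∈ cl ω.toFinset b ↔ (v ∈ cl ζX b ∨ v ∈ cl ζY b)) by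
    exact key _ _ (fun e => by simp only [Set.mem_toFinset]) (fun e => by simp only [Set.mem_toFinset])
  intro ζX ζY hX hY
  obtain ⟨hωζ, -, -, hsep⟩ := ApexTwoSum.blocks_of_eq hsepD hω hX hY
  rw [hωζ]
  exact APL.series_oc_iff _ _ b v (fun x h1 h2 => (hsep x h1 h2).symm)

include hsepD hac hbc hvc hcX haY in
/-- **Join rule for the far terminal `c`** (private to `DY`): `c ∈ C(a)` iff (`b ∈ C(a)` and `c ∈ C_Y(b)`) or
(`v ∈ C(a)` and `c ∈ C_Y(v)`) — every `a–c` path passes `b` or `v`. [this work] -/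
theorem glued_c_iff {ω : BondConfig V} (hω : ω ⊆ ↑DX ∪ ↑DY) :
    c ∈ cl ω.toFinset a ↔
      ((b ∈ cl ω.toFinset a ∧ (ω \ ↑DX) ∈ {η : BondConfig V | c ∈ cl η.toFinset b}) ∨
        (v ∈ cl ω.toFinset a ∧ (ω \ ↑DX) ∈ {η : BondConfig V | c ∈ cl η.toFinset v})) := by
  simp only [Set.mem_setOf_eq]
  suffices key : ∀ ζX ζY : Finset (Sym2 V), (∀ e, e ∈ ζX ↔ e ∈ ω ∩ (↑DX : Set (Sym2 V))) →
      (∀ e, e ∈ ζY ↔ e ∈ ω \ (↑DX : Set (Sym2 V))) →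
      (c ∈ cl ω.toFinset a ↔ ((b ∈ cl ω.toFinset a ∧ c ∈ cl ζY b) ∨ (v ∈ cl ω.toFinset a ∧ c ∈ cl ζY v))) by
    exact key (ω ∩ (↑DX : Set (Sym2 V))).toFinset _ (fun e => by simp only [Set.mem_toFinset])
      (fun e => by simp only [Set.mem_toFinset])
  intro ζX ζY hX hY
  obtain ⟨hωζ, hXD, hYD, hsep⟩ := ApexTwoSum.blocks_of_eq hsepD hω hX hY
  have hsep3' : ∀ x : V, (∃ e ∈ ζX, x ∈ e) → (∃ e ∈ ζY, x ∈ e) → (x = a ∨ x = b ∨ x = v) :=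
    fun x h1 h2 => (hsep x h1 h2).elim (fun h => Or.inr (Or.inr h)) (fun h => Or.inr (Or.inl h))
  have hcX' : ∀ e ∈ ζX, c ∉ e := fun e he => hcX e (hXD he)
  have haY' : ∀ e ∈ ζY, a ∉ e := fun e he => haY e (hYD he)
  have hY1 : cl ζY b ⊆ cl (ζX ∪ ζY) b := cl_mono Finset.subset_union_right b
  have hY2 : cl ζY v ⊆ cl (ζX ∪ ζY) v := cl_mono Finset.subset_union_right v
  -- `c` is not in any `X`-cluster of another vertex
  have noX : ∀ t, t ≠ c → c ∉ cl ζX t := fun t ht h => by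
    obtain ⟨e, he, hce⟩ := exists_mem_edge_of_mem_cl h (Ne.symm ht)
    exact hcX' e he hce
  rw [hωζ]
  constructor
  · intro hc
    obtain ⟨t, hJ, hct⟩ := APL.glued_cl_core ζX ζY a b v hsep3' hc
    rcases hJ with rfl | ⟨rfl, hb⟩ | ⟨rfl, hv⟩
    · rcases hct with h | h
      · exact (noX t hac h).elim
      · exact absurd (ApexTwoSum.eq_of_mem_cl_of_forall_not_mem haY' h) (Ne.symm hac)
    · refine Or.inl ⟨(APL.glued_ab_iff ζX ζY a t v hsep3').2 hb, ?_⟩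
      rcases hct with h | h
      · exact (noX t hbc h).elim
      · exact h
    · refine Or.inr ⟨(APL.glued_ac_iff ζX ζY a b t hsep3').2 hv, ?_⟩
      rcases hct with h | h
      · exact (noX t hvc h).elim
      · exact h
  · rintro (⟨hb, hcb⟩ | ⟨hv, hcv⟩)
    · exact mem_cl_trans hb (hY1 hcb)
    · exact mem_cl_trans hv (hY2 hcv)

include hsepD hab hav haY in
/-- `glued_b_iff` with the symmetric atom `b ∈ C(v)`. [this work] -/
theorem glued_b_iff' {ω : BondConfig V} (hω : ω ⊆ ↑DX ∪ ↑DY) :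
    b ∈ cl ω.toFinset a ↔
      ((ω ∩ ↑DX) ∈ {η : BondConfig V | b ∈ cl η.toFinset a} ∨
        ((ω ∩ ↑DX) ∈ {η : BondConfig V | v ∈ cl η.toFinset a} ∧
          ((ω ∩ ↑DX) ∈ {η : BondConfig V | b ∈ cl η.toFinset v} ∨ (ω \ ↑DX) ∈ {η : BondConfig V | b ∈ cl η.toFinset v}))) := by
  have e : {η : BondConfig V | v ∈ cl η.toFinset b} = {η : BondConfig V | b ∈ cl η.toFinset v} := by
    ext η; exact mem_cl_comm
  rw [← e]; exact glued_b_iff hab hav hsepD haY hω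

include hsepD hab hav haY in
/-- `glued_v_iff` with the symmetric atom `b ∈ C(v)`. [this work] -/
theorem glued_v_iff' {ω : BondConfig V} (hω : ω ⊆ ↑DX ∪ ↑DY) :
    v ∈ cl ω.toFinset a ↔
      ((ω ∩ ↑DX) ∈ {η : BondConfig V | v ∈ cl η.toFinset a} ∨
        ((ω ∩ ↑DX) ∈ {η : BondConfig V | b ∈ cl η.toFinset a} ∧
          ((ω ∩ ↑DX) ∈ {η : BondConfig V | b ∈ cl η.toFinset v} ∨ (ω \ ↑DX) ∈ {η : BondConfig V | b ∈ cl η.toFinset v}))) := by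
  have e : {η : BondConfig V | v ∈ cl η.toFinset b} = {η : BondConfig V | b ∈ cl η.toFinset v} := by
    ext η; exact mem_cl_comm
  rw [← e]; exact glued_v_iff hab hav hsepD haY hω

include hsepD in
/-- **Join rule for `b ~ v`** (atom `b ∈ C(v)`): in the glued configuration iff in some block. [this work] -/
theorem glued_vb_iff {ω : BondConfig V} (hω : ω ⊆ ↑DX ∪ ↑DY) :
    b ∈ cl ω.toFinset v ↔
      ((ω ∩ ↑DX) ∈ {η : BondConfig V | b ∈ cl η.toFinset v} ∨ (ω \ ↑DX) ∈ {η : BondConfig V | b ∈ cl η.toFinset v}) := by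
  simp only [Set.mem_setOf_eq]
  suffices key : ∀ ζX ζY : Finset (Sym2 V), (∀ e, e ∈ ζX ↔ e ∈ ω ∩ (↑DX : Set (Sym2 V))) →
      (∀ e, e ∈ ζY ↔ e ∈ ω \ (↑DX : Set (Sym2 V))) → (b ∈ cl ω.toFinset v ↔ (b ∈ cl ζX v ∨ b ∈ cl ζY v)) by
    exact key _ _ (fun e => by simp only [Set.mem_toFinset]) (fun e => by simp only [Set.mem_toFinset])
  intro ζX ζY hX hY
  obtain ⟨hωζ, -, -, hsep⟩ := ApexTwoSum.blocks_of_eq hsepD hω hX hY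
  rw [hωζ]
  exact APL.series_oc_iff _ _ v b hsep

end Join

/-! ### The separation rule -/

section Separation

variable (hab : a ≠ b) (hav : a ≠ v) (hac : a ≠ c) (hbc : b ≠ c) (hvc : v ≠ c) (hbv : b ≠ v)
  (hsepD : ∀ x : V, (∃ e ∈ DX, x ∈ e) → (∃ e ∈ DY, x ∈ e) → (x = v ∨ x = b))
  (haY : ∀ e ∈ DY, a ∉ e) (hcX : ∀ e ∈ DX, c ∉ e)

include hsepD hbc hvc hcX in
/-- **Separation rule, hub inside the cluster** (Finset form).  `ζ_X ⊆ DX`, `ζ_Y ⊆ DY`, `v ∈ C(a)`, `b ∉ C(a)` (glued clusters):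
`C(a)` meets every `b–c` path of `DX ∪ DY` iff `C_Y(v)` meets every `b–c` path of `DY`. [this work] -/
theorem sep_iff_of_mem_fin {ζX ζY : Finset (Sym2 V)} (hζX : ζX ⊆ DX)
    (hsep : ∀ x : V, (∃ e ∈ ζX, x ∈ e) → (∃ e ∈ ζY, x ∈ e) → (x = v ∨ x = b))
    (hv : v ∈ cl (ζX ∪ ζY) a) (hb : b ∉ cl (ζX ∪ ζY) a) :
    Sep (DX ∪ DY) (cl (ζX ∪ ζY) a) b c ↔ Sep DY (cl ζY v) b c := by
  -- the glued cluster of `a` is the glued cluster of `v`, which splits off `b`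
  have hK : cl (ζX ∪ ζY) a = cl (ζX ∪ ζY) v := by
    ext x
    exact ⟨fun h => mem_cl_trans (mem_cl_comm.1 hv) h, fun h => mem_cl_trans hv h⟩
  have hbv' : b ∉ cl (ζX ∪ ζY) v := fun h => hb (hK ▸ h)
  have hbX : b ∉ cl ζX v := fun h => hbv' (cl_mono Finset.subset_union_left v h)
  have hbY : b ∉ cl ζY v := fun h => hbv' (cl_mono Finset.subset_union_right v h)
  have hsep3 : ∀ x : V, (∃ e ∈ ζX, x ∈ e) → (∃ e ∈ ζY, x ∈ e) → (x = v ∨ x = b ∨ x = b) :=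
    fun x h1 h2 => (hsep x h1 h2).imp id (fun h => Or.inl h)
  have hsepD3 : ∀ x : V, (∃ e ∈ DX, x ∈ e) → (∃ e ∈ DY, x ∈ e) → (x = v ∨ x = b ∨ x = b) :=
    fun x h1 h2 => (hsepD x h1 h2).imp id (fun h => Or.inl h)
  have hcl : cl (ζX ∪ ζY) v = cl ζX v ∪ cl ζY v := ThreeSum.cl_union_eq hsep3 hbX hbX hbY hbY
  unfold RefinedRowR3.Sep
  rw [hK, hcl, Finset.union_sdiff_distrib, ThreeSum.sdiff_touch_union_right hsepD3 hζX hbX hbX]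
  set EX := DX \ touch (cl ζX v ∪ cl ζY v) with hEX
  set EY := DY \ touch (cl ζY v) with hEY
  have hvX : ∀ e ∈ EX, v ∉ e := fun e he hve => by
    rw [hEX, Finset.mem_sdiff] at he
    exact he.2 (mem_touch.2 ⟨v, Finset.mem_union.2 (Or.inl (mem_cl_self _ _)), hve⟩)
  have hvY : ∀ e ∈ EY, v ∉ e := fun e he hve => by
    rw [hEY, Finset.mem_sdiff] at he
    exact he.2 (mem_touch.2 ⟨v, mem_cl_self _ _, hve⟩)
  -- the two pieces off the clusters meet only in `b`
  have hsepE : ∀ x : V, (∃ e ∈ EX, x ∈ e) → (∃ e ∈ EY, x ∈ e) → (x = b ∨ x = v) := by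
    rintro x ⟨e, he, hxe⟩ ⟨e', he', hxe'⟩
    have h1 : e ∈ DX := by rw [hEX, Finset.mem_sdiff] at he; exact he.1
    have h2 : e' ∈ DY := by rw [hEY, Finset.mem_sdiff] at he'; exact he'.1
    exact (hsepD x ⟨e, h1, hxe⟩ ⟨e', h2, hxe'⟩).symm
  have hcEX : ∀ e ∈ EX, c ∈ e → c = v := fun e he hce => by
    rw [hEX, Finset.mem_sdiff] at he; exact absurd hce (hcX e he.1)
  rw [APL.series_ov_iff EX EY b v c hsepE hcEX hbc.symm]
  constructor
  · intro hn h1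
    exact hn (Or.inl h1)
  · rintro hn (h1 | ⟨h2, -⟩)
    · exact hn h1
    · exact hvc (ApexTwoSum.eq_of_mem_cl_of_forall_not_mem hvY (mem_cl_comm.1 h2)).symm

include hsepD hab hav haY in
/-- **No separation when the cluster of `a` misses the cut** (Finset form): if `b, v ∉ C(a)` and `b, c` are joined in the support
`DY`, the cluster of `a` does not meet every `b–c` path. [this work] -/
theorem not_sep_of_not_mem_fin {ζX ζY : Finset (Sym2 V)} (hζX : ζX ⊆ DX) (hζY : ζY ⊆ DY)
    (hsep : ∀ x : V, (∃ e ∈ ζX, x ∈ e) → (∃ e ∈ ζY, x ∈ e) → (x = v ∨ x = b))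
    (hb : b ∉ cl (ζX ∪ ζY) a) (hv : v ∉ cl (ζX ∪ ζY) a) (hY : c ∈ cl DY b) :
    ¬ Sep (DX ∪ DY) (cl (ζX ∪ ζY) a) b c := by
  have hbX : b ∉ cl ζX a := fun h => hb (cl_mono Finset.subset_union_left a h)
  have hvX : v ∉ cl ζX a := fun h => hv (cl_mono Finset.subset_union_left a h)
  have haY' : ∀ e ∈ ζY, a ∉ e := fun e he => haY e (hζY he)
  have hbY : b ∉ cl ζY a := fun h => hab (ApexTwoSum.eq_of_mem_cl_of_forall_not_mem haY' h).symm
  have hvY : v ∉ cl ζY a := fun h => hav (ApexTwoSum.eq_of_mem_cl_of_forall_not_mem haY' h).symm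
  have hsep3 : ∀ x : V, (∃ e ∈ ζX, x ∈ e) → (∃ e ∈ ζY, x ∈ e) → (x = a ∨ x = b ∨ x = v) :=
    fun x h1 h2 => (hsep x h1 h2).elim (fun h => Or.inr (Or.inr h)) (fun h => Or.inr (Or.inl h))
  have hsepD3 : ∀ x : V, (∃ e ∈ DX, x ∈ e) → (∃ e ∈ DY, x ∈ e) → (x = a ∨ x = b ∨ x = v) :=
    fun x h1 h2 => (hsepD x h1 h2).elim (fun h => Or.inr (Or.inr h)) (fun h => Or.inr (Or.inl h))
  have hcl : cl (ζX ∪ ζY) a = cl ζX a ∪ cl ζY a := ThreeSum.cl_union_eq hsep3 hbX hvX hbY hvY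
  intro hS
  unfold RefinedRowR3.Sep at hS
  rw [hcl, Finset.union_sdiff_distrib, ThreeSum.sdiff_touch_union_right hsepD3 hζX hbX hvX] at hS
  -- no pair of `DY` touches `C_Y(a) = {a}`
  have hDY : DY \ touch (cl ζY a) = DY := by
    refine Finset.sdiff_eq_self_of_disjoint (Finset.disjoint_left.2 fun e he hte => ?_)
    obtain ⟨x, hx, hxe⟩ := mem_touch.1 hte
    have hxa : x = a := ApexTwoSum.eq_of_mem_cl_of_forall_not_mem haY' hx
    exact haY e he (hxa ▸ hxe)
  rw [hDY] at hS
  exact hS (cl_mono Finset.subset_union_right b hY)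

include hsepD hbc hvc hcX in
/-- **Separation rule, hub inside the cluster** (event form, blocks read off from the goal). [this work] -/
theorem sep_iff_of_mem {ω : BondConfig V} (hω : ω ⊆ ↑DX ∪ ↑DY) (hv : v ∈ cl ω.toFinset a) (hb : b ∉ cl ω.toFinset a) :
    Sep (DX ∪ DY) (cl ω.toFinset a) b c ↔ (ω \ ↑DX) ∈ {η : BondConfig V | Sep DY (cl η.toFinset v) b c} := by
  simp only [Set.mem_setOf_eq]
  suffices key : ∀ ζX ζY : Finset (Sym2 V), (∀ e, e ∈ ζX ↔ e ∈ ω ∩ (↑DX : Set (Sym2 V))) →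
      (∀ e, e ∈ ζY ↔ e ∈ ω \ (↑DX : Set (Sym2 V))) →
      (Sep (DX ∪ DY) (cl ω.toFinset a) b c ↔ Sep DY (cl ζY v) b c) by
    exact key (ω ∩ (↑DX : Set (Sym2 V))).toFinset _ (fun e => by simp only [Set.mem_toFinset])
      (fun e => by simp only [Set.mem_toFinset])
  intro ζX ζY hX hY
  obtain ⟨hωζ, hXD, -, hsep⟩ := ApexTwoSum.blocks_of_eq hsepD hω hX hY
  rw [hωζ] at hv hb ⊢
  exact sep_iff_of_mem_fin hbc hvc hsepD hcX hXD hsep hv hb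

include hsepD hab hav haY in
/-- **No separation when the cluster of `a` misses the cut** (event form). [this work] -/
theorem not_sep_of_not_mem {ω : BondConfig V} (hω : ω ⊆ ↑DX ∪ ↑DY) (hb : b ∉ cl ω.toFinset a)
    (hv : v ∉ cl ω.toFinset a) (hY : c ∈ cl DY b) : ¬ Sep (DX ∪ DY) (cl ω.toFinset a) b c := by
  suffices key : ∀ ζX ζY : Finset (Sym2 V), (∀ e, e ∈ ζX ↔ e ∈ ω ∩ (↑DX : Set (Sym2 V))) →
      (∀ e, e ∈ ζY ↔ e ∈ ω \ (↑DX : Set (Sym2 V))) → ¬ Sep (DX ∪ DY) (cl ω.toFinset a) b c by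
    exact key (ω ∩ (↑DX : Set (Sym2 V))).toFinset (ω \ (↑DX : Set (Sym2 V))).toFinset
      (fun e => by simp only [Set.mem_toFinset]) (fun e => by simp only [Set.mem_toFinset])
  intro ζX ζY hXm hYm
  obtain ⟨hωζ, hXD, hYD, hsep⟩ := ApexTwoSum.blocks_of_eq hsepD hω hXm hYm
  rw [hωζ] at hv hb ⊢
  exact not_sep_of_not_mem_fin hab hav hsepD haY hXD hYD hsep hb hv hY

/-- An open `b–c` path off `C_Y(v)` in the `Y`-block defeats separation in `DY` (event form). [this work] -/
theorem not_sepY_of_mem' {ω : BondConfig V} (hω : ω ⊆ ↑DX ∪ ↑DY)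
    (hb : (ω \ ↑DX) ∉ {η : BondConfig V | b ∈ cl η.toFinset v})
    (hc : (ω \ ↑DX) ∈ {η : BondConfig V | c ∈ cl η.toFinset b}) :
    (ω \ ↑DX) ∉ {η : BondConfig V | Sep DY (cl η.toFinset v) b c} := by
  simp only [Set.mem_setOf_eq] at hb hc ⊢
  suffices key : ∀ ζ : Finset (Sym2 V), (∀ e, e ∈ ζ ↔ e ∈ ω \ (↑DX : Set (Sym2 V))) →
      b ∉ cl ζ v → c ∈ cl ζ b → ¬ Sep DY (cl ζ v) b c by
    exact key _ (fun e => by simp only [Set.mem_toFinset]) hb hc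
  intro ζ hζ hb' hc'
  refine ThreeSum.not_sep_of_mem_cl (fun e he => ?_) hb' hc'
  have he' := (hζ e).1 he
  rcases hω he'.1 with h' | h'
  · exact absurd h' he'.2
  · exact h'

end Separation


end TerminalTwoSum

end Summit.CriticalPhenomena.PercolationContinuityZ3.Theorems
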